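import Literature.NumberTheory.EllipticCurves.Isogeny
import HarnessLib

/-!
# The identity isogeny: proofs of `Isogeny.nonempty_self` and `IsIsogenous.refl`

Sibling file of `Literature.NumberTheory.EllipticCurves.Isogeny` (D-0014 append protocol, kept
light: it imports only `Isogeny.lean`). It constructs the identity isogeny `[1] : E → E`
(Silverman, *The Arithmetic of Elliptic Curves*, III.4, Example 4.1: the multiplication-by-`m`
isogeny, "if `E` is defined over `K`, then `[m]` is defined over `K`", here `m = 1`) as a term of
the prelude structure `WeierstrassCurve.Isogeny W W` — the identity homomorphism of `E(K̄)`,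
algebraic through the rational map `(x, y) ↦ (x/1, y/1)` off the exceptional set `{O}`,
`Γ_K`-equivariant, with kernel `{O}` — and discharges with it the two named facts of
`Isogeny.lean`

* `WeierstrassCurve.Isogeny.nonempty_self W : ∀ [W.IsElliptic], Nonempty (Isogeny W W)`
  (`Isogeny.nonempty_self_holds`), and
* `WeierstrassCurve.IsIsogenous.refl W : ∀ [W.IsElliptic], IsIsogenous W W`
  (`IsIsogenous.refl_holds`),

for every Weierstrass curve `W` over any field `K` (the constructions do not use `IsElliptic`).

## Contents

* `WeierstrassCurve.agreesWithRationalMapAt_id`, `WeierstrassCurve.isAlgebraicOn_id`: the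
  identity of `E(K̄)` agrees with `(X/1, Y/1)` at every affine point, hence is `IsAlgebraicOn`.
* `WeierstrassCurve.Isogeny.id W : Isogeny W W`, with `Isogeny.id_apply` (`simp`) and
  `Isogeny.degree_id : (Isogeny.id W).degree = 1`.
* `WeierstrassCurve.Isogeny.nonempty_self_holds`, `WeierstrassCurve.IsIsogenous.refl_holds`.

Mathlib has no isogenies (the prelude `Isogeny.lean` records this); `lean search` for
`Isogeny.id`, `isAlgebraicOn_id`, `nonempty_self_holds`, `refl_holds` in
`Literature/NumberTheory/EllipticCurves` found nothing (the sibling `IsogenyHomProofs.lean` treats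
sums and negatives of isogenies, not the identity). Declarations are deliberate dot-notation
extensions in `namespace WeierstrassCurve`, like the prelude's.

## References

* J. H. Silverman, *The Arithmetic of Elliptic Curves*, 2nd ed., GTM 106 (2009), III.4
  (isogenies; Example 4.1, the isogeny `[m]`), III.6 (isogeny as an equivalence relation).
-/

noncomputable section

open scoped Classical

universe u

namespace WeierstrassCurve

open MvPolynomial

variable {K : Type u} [Field K] (W : WeierstrassCurve K)

/-- The identity map of `E(K̄)` agrees with the rational map `(x, y) ↦ (x/1, y/1)` at every
affine point (so the exceptional set of `AgreesWithRationalMapAt` for the identity is `{O}`).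
Silverman, *AEC*, III.4, Example 4.1 (`[1]`). [folklore] -/
theorem agreesWithRationalMapAt_id {P : W.geomPoints} (hP : P ≠ 0) :
    AgreesWithRationalMapAt W W (X 0) 1 (X 1) 1 id P := by
  rcases P with _ | ⟨x, y, h⟩
  · exact absurd rfl hP
  · refine ⟨x, y, h, rfl, by simp, by simp, ?_⟩
    refine ⟨by simpa using h, ?_⟩
    show Affine.Point.some x y h = _
    congr 1 <;> simp

/-- The identity map of `E(K̄)` is algebraic in the sense of the prelude's `IsAlgebraicOn`
(formulae `(X, 1, Y, 1)`, exceptional set `⊆ {O}`). Silverman, *AEC*, III.4, Example 4.1.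
[folklore] -/
theorem isAlgebraicOn_id : IsAlgebraicOn W W id :=
  ⟨X 0, 1, X 1, 1, (Set.finite_singleton (0 : W.geomPoints)).subset fun P hP => by
    by_contra h0
    exact hP (agreesWithRationalMapAt_id W h0)⟩

/-- **The identity isogeny** `[1] : E → E` (Silverman, *AEC*, III.4, Example 4.1 with `m = 1`:
"if `E` is defined over `K`, then `[m]` is defined over `K`") as a term of the prelude's
`Isogeny W W`: the identity homomorphism of `E(K̄)`, algebraic via `(x, y) ↦ (x, y)` off `{O}`,
`Γ_K`-equivariant, with kernel `{O}`. [cite: SilvermanAEC2009, III.4, Example 4.1] -/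
def Isogeny.id : Isogeny W W where
  toAddMonoidHom := AddMonoidHom.id _
  isAlgebraic := isAlgebraicOn_id W
  equivariant _ _ := rfl
  finite_ker := by
    refine (Set.finite_singleton (0 : W.geomPoints)).subset fun P hP => ?_
    simpa [AddMonoidHom.mem_ker] using hP

/-- The identity isogeny acts as the identity on `E(K̄)`. Silverman, *AEC*, III.4. [folklore] -/
@[simp]
theorem Isogeny.id_apply (P : W.geomPoints) : Isogeny.id W P = P :=
  rfl

/-- The kernel of the identity isogeny is trivial. Silverman, *AEC*, III.4. [folklore] -/
theorem Isogeny.ker_id : (Isogeny.id W).toAddMonoidHom.ker = ⊥ := by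
  ext P
  simp [Isogeny.id]

/-- The identity isogeny has degree (`= #ker`, the prelude's `Isogeny.degree`) one.
Silverman, *AEC*, III.4 and III.6.2(d) (`deg [m] = m²`). [folklore] -/
theorem Isogeny.degree_id : (Isogeny.id W).degree = 1 := by
  unfold Isogeny.degree
  rw [Isogeny.ker_id]
  simp

/-- The identity isogeny is cyclic (its kernel `{O}` is a cyclic group), in the sense of the
prelude's `Isogeny.IsCyclic`. Silverman, *AEC*, III.4. [folklore] -/
theorem Isogeny.isCyclic_id : (Isogeny.id W).IsCyclic := by
  unfold Isogeny.IsCyclic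
  rw [Isogeny.ker_id]
  infer_instance

/-- **Discharge of the named fact `WeierstrassCurve.Isogeny.nonempty_self`** (`Isogeny.lean`):
every curve carries the identity isogeny. Silverman, *AEC*, III.4, Example 4.1.
[cite: SilvermanAEC2009, III.4, Example 4.1] -/
theorem Isogeny.nonempty_self_holds : Isogeny.nonempty_self W := by
  intro _
  exact ⟨Isogeny.id W⟩

/-- **Discharge of the named fact `WeierstrassCurve.IsIsogenous.refl`** (`Isogeny.lean`):
isogeny over `K` is reflexive. Silverman, *AEC*, III.4 (Example 4.1) and III.6 (isogeny is an
equivalence relation). [cite: SilvermanAEC2009, III.4, Example 4.1] -/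
theorem IsIsogenous.refl_holds : IsIsogenous.refl W := by
  intro _
  exact ⟨Isogeny.id W⟩

/-- Reflexivity of `IsIsogenous` without the `IsElliptic` hypothesis of `IsIsogenous.refl`:
`W ~ W` for every Weierstrass curve `W` (the identity isogeny). Silverman, *AEC*, III.4.
[folklore] -/
theorem isIsogenous_self : IsIsogenous W W :=
  ⟨Isogeny.id W⟩

end WeierstrassCurve

end
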